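import Literature.AlgebraicGeometry.AbelianSchemes.DualPairHatCocycle
import Literature.AlgebraicGeometry.AbelianSchemes.DualPairOfGluedHatGlue
import Literature.AlgebraicGeometry.AbelianSchemes.DualPairOfGluedHatCompat
import HarnessLib

/-!
# F-3 PARENT LINE `Cruxes/HDel/Lines/F3DualAbelianScheme` — the letter (Z) `stub_F3Z` PROVED
# («dual pairs glue along a Zariski cover of the base»; [BoschLutkebohmertRaynaud1990] §8.1 Prop. 4, [MumfordAV1970] §13 p. 125)

Cell `hodgecm-mathlib` (D-0151 / D-0183 FLOOR 0), programme P1, sub-line F-3, parent line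
`Cruxes/HDel/Lines/F3DualAbelianScheme.lean` (ed. 1.4 7200c2d9), node **(Z)** (:87).
HC_CM is proved only modulo the 7 printed citations until rung 0 closes; nothing in this file is about HC.

`stub_F3Z_holds` restates the tree letter `Summit.HodgeConjecture.CorCM.Cruxes.HypDel.F3DualAbelianScheme.stub_F3Z` TOKEN FOR TOKEN
and proves it in three lines over the (Z) chain, all ★: FILE H part 2b ★ `AbelianSchemes/DualPairHatCocycle`
(`exists_gluedHat`: the hat-normalised chart duals' hats glue UNCONDITIONALLY — transitions by dual transport, cocycle identity because
dual pairs are unique up to a unique isomorphism — to an abelian scheme `H → S` with cartesian open charts and the glue condition),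
★ `AbelianSchemes/DualPairOfGluedHatCompat` (`nonempty_pullback_chartP_iso_of_gluedHat`: chart compatibility of the chart Poincaré
sheaves over `H`, from the glue condition and the Poincaré clause of the hat transitions) and ★ `AbelianSchemes/DualPairOfGluedHatGlue`
(`nonempty_dualPair_of_gluedHat_of_compat`: the chart Poincaré sheaves glue — ★ `Modules/RigidifiedZariskiGluing`, the rigidified
Picard functor is a Zariski sheaf — to a rank-one `𝒫` on `A ×_S H`, re-rigidified, fibrewise `Pic⁰`, universal: the four `DualPair`
fields, ★ `DualPairOfGluedHat`).  The letter is polymorphic in the INDEX universe of the cover `𝒰`; the chain runs on Mathlib's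
re-indexing `𝒰.ulift` (`𝒰.ulift.f x = 𝒰.f (𝒰.idx x)`, the same charts).

## References
* [BoschLutkebohmertRaynaud1990] S. Bosch, W. Lütkebohmert, M. Raynaud, *Néron Models* (1990), §8.1 Prop. 4 (pp. 204–205) (the
  rigidified Picard functor is a sheaf for the Zariski topology).
* [MumfordAV1970] D. Mumford, *Abelian Varieties* (1970), §13 p. 125 (normalised isomorphisms of rigidified bundles are unique, so local
  data glue).
* [MumfordFogartyKirwan1994] D. Mumford, J. Fogarty, F. Kirwan, *Geometric Invariant Theory*, 3rd ed. (1994), Ch. 6 §1 Cor. 6.8 (p. 118).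
-/

noncomputable section

open CategoryTheory CategoryTheory.Limits AlgebraicGeometry
open Literature.AlgebraicGeometry.AbelianSchemes Literature.AlgebraicGeometry.Motives
  Literature.AlgebraicGeometry.AbelianVarieties Literature.AlgebraicGeometry.Modules

namespace Summit.HodgeConjecture.CorCM.Cruxes.HypDel.F3DualAbelianScheme

/-- **(Z) `stub_F3Z` PROVED — «`DualPair`s GLUE ALONG A ZARISKI COVER OF THE BASE»**: if `A ×_S Uᵢ` has a dual pair for every member
`Uᵢ → S` of an open cover of the locally Noetherian base `S`, then `A` has a dual pair.  The tree letter VERBATIM (`Scheme.{0}`):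
`exists_gluedHat` ∘ `nonempty_pullback_chartP_iso_of_gluedHat` ∘ `nonempty_dualPair_of_gluedHat_of_compat`, run on the re-indexed cover
`𝒰.ulift` with the chart duals re-indexed along `𝒰.idx`.
[cite: BoschLutkebohmertRaynaud1990, §8.1 Prop. 4 (pp. 204–205)] [cite: MumfordAV1970, §13 p. 125] -/
theorem stub_F3Z_holds : ∀ ⦃S : Scheme.{0}⦄ [IsLocallyNoetherian S] (A : AbelianSchemeOver S) (𝒰 : S.OpenCover),
    (∀ i, (A.baseChange (𝒰.f i)).DualPair) → Nonempty A.DualPair := by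
  intro S _ A 𝒰 D
  obtain ⟨H, χ, hχ, hglue⟩ := A.exists_gluedHat 𝒰.ulift (fun x => D (𝒰.idx x))
  exact A.nonempty_dualPair_of_gluedHat_of_compat 𝒰.ulift (A.chartDual 𝒰.ulift fun x => D (𝒰.idx x)) H χ hχ
    (fun T b i j mi mj hmi hmj =>
      A.nonempty_pullback_chartP_iso_of_gluedHat 𝒰.ulift (fun x => D (𝒰.idx x)) H χ hχ hglue b i j mi mj hmi hmj)

end Summit.HodgeConjecture.CorCM.Cruxes.HypDel.F3DualAbelianScheme

end
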